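import Summits.BirchSwinnertonDyer.Rank1Residual.F1Sign2.ParitySymbolCocycleAtTwoProofsGluedPair
import HarnessLib

/-!
# Cell `bsd-f1-sign2`, lens `-desc` g14 (MEMO-desc §22.13-add3/4): row DESC-§22-H′ `Kummer.KummerHalvingCriterion` — CASSELS' LEMMA
# `P ∈ 2W(ℚ) ⟺ 4x_P − θ_W ∈ L_W^{2}` for EVERY `W : y² = x³ + a₂x² + a₄x + a₆` over `ℚ` and every rational point — TYPED AND PROVED

TYPER FILING (seat `bsd-f1-sign2-ty` g8; CANDIDATES.md row DESC-§22-H′; -desc CANDIDATES-delta ADDENDUM 7‴ 2026-08-28T10:23:32Z): part A of two.  Source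
`HOME/MEMO-desc-data/g14/lean/KummerGeneral.lean` 55246eaab182a892 (288 l.; imports only the landed `…ProofsGluedPair`; ns `…F1Sign2.Kummer` KEPT as in the
planner's file; farm rc 0 standalone; A+B concat `KummerGeneral-v3-concat.lean` 1d0020498e750765 rc 0 · 0 warn · 0 sorry, axioms propext, Classical.choice,
Quot.sound) lines 28–281 VERBATIM: `Kummer.coords_eq_zero`, `exists_coords`, `equation_of_a₁_a₃`, `negY_of_a₁_a₃`, `b₂_of_a₁`, `b₄_of_a₁_a₃`, `b₆_of_a₃`,
`root_relation_of_a₁_a₃`, `isSquare_of_halves`, `exists_halves_of_isSquare`, `halves_iff_isSquare`, the row def `Kummer.KummerHalvingCriterion` with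
`Kummer.kummerHalvingCriterion_holds`, and `halves_iff_isSquare_gmCurve`; the planner's last corollary `halves_iff_isSquare_gmPartner` is DROPPED (duplicate of the
landed `MarkedPoint.halves_iff_isSquare_kummer`, `KummerHalvingCriterionAtTwo.lean` p624323 — -desc: «you may drop»).  Docstrings added where missing; REF1/REF2
slots in the row docstring.  Part B = `F1Sign2/KummerRankCertificate.lean` (rows H″, H‴).  Builder `tools/mk_desc22kummer.py` (published under
`HOME/MEMO-ty-data/g8/`).  No `sorry`, no `instance`, no `notation`, no Literature fact.  PARTITION: none; beyond-print theorem: no (KNOWN support, kernel).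

Planner's docstring (verbatim, -desc g14 `KummerGeneral.lean`):
# Cell `bsd-f1-sign2`, lens `-desc` g14 (MEMO-desc §22.13-add3/4): row DESC-§22-H′ `KummerHalvingCriterion` — CASSELS' LEMMA
# `P ∈ 2E(ℚ) ⟺ 4x_P − θ ∈ L^{2}` for EVERY Weierstrass curve `y² = x³ + a₂x² + a₄x + a₆` over `ℚ` (`a₁ = a₃ = 0`) and every rational point.

`L = twoDivisionAlgebra W = ℚ[T]/(c_W)`, `c_W(T) = T³ + b₂T² + 8b₄T + 16b₆` (the `u = 4x` cubic; `b₂ = 4a₂`, `b₄ = 2a₄`, `b₆ = 4a₆` here), `θ = twoDivisionRoot W`.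
* `Kummer.coords_eq_zero`, `Kummer.exists_coords` — coordinates `α₀ + α₁θ + α₂θ²` (general `W`; same proofs as `MarkedPoint.coords_eq_zero/exists_coords`);
* `Kummer.isSquare_of_halves` — `Q + Q = P ⇒ 4x_P − θ = (M/(16y_Q))²`, `M = (4x_Q − θ)² − (3θ² + 2b₂θ + 8b₄)·` (i.e. `− c_W′(θ)`), one `linear_combination`
  (certificate `256P₃² − 64g(x_Q)(b₂ + 8x_Q + θ)·4 − M² ≡ 0 mod c_W(θ)` with `P₃ = 3x_Q² + 2a₂x_Q + a₄`, `P₃² = 4y_Q²(x_P + a₂ + 2x_Q)`);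
* `Kummer.exists_halves_of_isSquare` — `4x_P − θ = (α₀ + α₁θ + α₂θ²)² ⇒ α₂ ≠ 0`, half `Q = (α₁/(4α₂) − a₂, −1/(8α₂))`, `2(±Q) = P`;
* `Kummer.halves_iff_isSquare`; **row H′** `kummerHalvingCriterion_holds : KummerHalvingCriterion`.
NO hypothesis beyond `a₁ = a₃ = 0`: `c_W` may be reducible (`L` a product of fields: the split case is the classical complete 2-descent triple
`(x − e₁, x − e₂, x − e₃)`), `W` may be singular (Mathlib's `Point` = nonsingular points). In print (field factors): Cassels, LMSST 24 (1991) §15 Lemma 2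
[cite: Cassels1991, §15 Lemma 2]; the explicit half and the uniform `AdjoinRoot` formulation are this file's. Specialises to row H (`gmPartner`,
`KummerHalving.lean`) and to `gmCurve`. No `sorry`, no `instance`, no `notation`; axioms propext / Classical.choice / Quot.sound.
-/

noncomputable section

open scoped Classical

open WeierstrassCurve Polynomial

namespace Summit.BirchSwinnertonDyer.Rank1Residual.F1Sign2.Kummer

/-! ## Coordinates in the cubic algebra (general `W`) -/

/-- Uniqueness of coordinates w.r.t. `1, θ, θ²` in `L = ℚ[X]/(c_W)`. -/
lemma coords_eq_zero (W : WeierstrassCurve ℚ) (r₀ r₁ r₂ : ℚ)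
    (h : algebraMap ℚ (twoDivisionAlgebra W) r₀ + algebraMap ℚ (twoDivisionAlgebra W) r₁ * twoDivisionRoot W + algebraMap ℚ (twoDivisionAlgebra W) r₂ * twoDivisionRoot W ^ 2 = 0) :
    r₀ = 0 ∧ r₁ = 0 ∧ r₂ = 0 := by
  have hmk : AdjoinRoot.mk (twoDivisionUCubic W) (C r₂ * X ^ 2 + C r₁ * X + C r₀) = 0 := by
    rw [← AdjoinRoot.aeval_eq]
    simp only [map_add, map_mul, map_pow, aeval_C, aeval_X]
    linear_combination h
  rw [AdjoinRoot.mk_eq_zero] at hmk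
  have hP0 : (C r₂ * X ^ 2 + C r₁ * X + C r₀ : ℚ[X]) = 0 := by
    by_contra hne
    have h1 := Polynomial.natDegree_le_of_dvd hmk hne
    have h2 : (C r₂ * X ^ 2 + C r₁ * X + C r₀ : ℚ[X]).natDegree ≤ 2 := Polynomial.natDegree_quadratic_le
    rw [twoDivisionUCubic_natDegree] at h1
    omega
  have e0 : r₀ = 0 := by simpa using congrArg (Polynomial.coeff · 0) hP0
  have e1 : r₁ = 0 := by simpa using congrArg (Polynomial.coeff · 1) hP0
  have e2 : r₂ = 0 := by simpa using congrArg (Polynomial.coeff · 2) hP0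
  exact ⟨e0, e1, e2⟩

/-- Every element of `L` has coordinates `α₀ + α₁θ + α₂θ²`. -/
lemma exists_coords (W : WeierstrassCurve ℚ) (v : (twoDivisionAlgebra W)) :
    ∃ α₀ α₁ α₂ : ℚ, v = algebraMap ℚ (twoDivisionAlgebra W) α₀ + algebraMap ℚ (twoDivisionAlgebra W) α₁ * twoDivisionRoot W + algebraMap ℚ (twoDivisionAlgebra W) α₂ * twoDivisionRoot W ^ 2 := by
  obtain ⟨p, hp⟩ := AdjoinRoot.mk_surjective v
  have hmonic := twoDivisionUCubic_monic W
  have hpq : AdjoinRoot.mk (twoDivisionUCubic W) p = AdjoinRoot.mk (twoDivisionUCubic W) (p %ₘ twoDivisionUCubic W) := by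
    rw [AdjoinRoot.mk_eq_mk, Polynomial.modByMonic_eq_sub_mul_div p (twoDivisionUCubic W)]
    exact ⟨p /ₘ twoDivisionUCubic W, by ring⟩
  have hne1 : twoDivisionUCubic W ≠ 1 := by
    intro h1
    have := congrArg Polynomial.natDegree h1
    rw [twoDivisionUCubic_natDegree] at this
    simp at this
  have hdeg : (p %ₘ twoDivisionUCubic W).natDegree ≤ 2 := by
    have := Polynomial.natDegree_modByMonic_lt p hmonic hne1
    rw [twoDivisionUCubic_natDegree] at this
    omega
  obtain ⟨c₀, c₁, c₂, hqexp⟩ : ∃ c₀ c₁ c₂ : ℚ, p %ₘ twoDivisionUCubic W = C c₀ + C c₁ * X + C c₂ * X ^ 2 := by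
    refine ⟨(p %ₘ twoDivisionUCubic W).coeff 0, (p %ₘ twoDivisionUCubic W).coeff 1, (p %ₘ twoDivisionUCubic W).coeff 2, ?_⟩
    ext n
    rcases n with _ | _ | _ | n
    · simp
    · simp
    · simp
    · rw [Polynomial.coeff_eq_zero_of_natDegree_lt (by omega)]
      simp
  refine ⟨c₀, c₁, c₂, ?_⟩
  rw [← hp, hpq, hqexp, ← AdjoinRoot.aeval_eq]
  simp only [map_add, map_mul, map_pow, aeval_C, aeval_X]

/-! ## Weierstrass data for `a₁ = a₃ = 0` -/

/-- The affine equation for `a₁ = a₃ = 0`: `y² = x³ + a₂x² + a₄x + a₆`. -/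
lemma equation_of_a₁_a₃ (W : WeierstrassCurve ℚ) (h1 : W.a₁ = 0) (h3 : W.a₃ = 0) {x y : ℚ} (h : W.toAffine.Equation x y) :
    y ^ 2 = x ^ 3 + W.a₂ * x ^ 2 + W.a₄ * x + W.a₆ := by
  rw [WeierstrassCurve.Affine.equation_iff] at h
  simp only [h1, h3, zero_mul, add_zero] at h ⊢
  linear_combination h

/-- `negY = −y` when `a₁ = a₃ = 0`. -/
lemma negY_of_a₁_a₃ (W : WeierstrassCurve ℚ) (h1 : W.a₁ = 0) (h3 : W.a₃ = 0) (x y : ℚ) : W.toAffine.negY x y = -y := by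
  simp [WeierstrassCurve.Affine.negY, h1, h3]

/-- `b₂ = 4a₂` when `a₁ = 0`. -/
lemma b₂_of_a₁ (W : WeierstrassCurve ℚ) (h1 : W.a₁ = 0) : W.b₂ = 4 * W.a₂ := by
  simp [WeierstrassCurve.b₂, h1]

/-- `b₄ = 2a₄` when `a₁ = a₃ = 0`. -/
lemma b₄_of_a₁_a₃ (W : WeierstrassCurve ℚ) (h1 : W.a₁ = 0) (h3 : W.a₃ = 0) : W.b₄ = 2 * W.a₄ := by
  simp [WeierstrassCurve.b₄, h1, h3]

/-- `b₆ = 4a₆` when `a₃ = 0`. -/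
lemma b₆_of_a₃ (W : WeierstrassCurve ℚ) (h3 : W.a₃ = 0) : W.b₆ = 4 * W.a₆ := by
  simp [WeierstrassCurve.b₆, h3]

/-- The cubic relation `θ³ + 4a₂θ² + 16a₄θ + 64a₆ = 0` in `L`. -/
lemma root_relation_of_a₁_a₃ (W : WeierstrassCurve ℚ) (h1 : W.a₁ = 0) (h3 : W.a₃ = 0) :
    twoDivisionRoot W ^ 3 + 4 * algebraMap ℚ (twoDivisionAlgebra W) W.a₂ * twoDivisionRoot W ^ 2 +
      16 * algebraMap ℚ (twoDivisionAlgebra W) W.a₄ * twoDivisionRoot W + 64 * algebraMap ℚ (twoDivisionAlgebra W) W.a₆ = 0 := by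
  have hF := GluedPairIdentity.root_relation W
  rw [b₂_of_a₁ W h1, b₄_of_a₁_a₃ W h1 h3, b₆_of_a₃ W h3] at hF
  simp only [map_mul, map_ofNat] at hF
  linear_combination hF

/-! ## Cassels' lemma -/

/-- Halving direction: `Q + Q = P ⇒ 4x_P − θ ∈ L^{2}`. -/
theorem isSquare_of_halves (W : WeierstrassCurve ℚ) (h1 : W.a₁ = 0) (h3 : W.a₃ = 0) {xP yP : ℚ} (hP : W.toAffine.Nonsingular xP yP)
    (Q : W.toAffine.Point) (hQ : Q + Q = WeierstrassCurve.Affine.Point.some xP yP hP) :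
    IsSquare (algebraMap ℚ (twoDivisionAlgebra W) (4 * xP) - twoDivisionRoot W) := by
  rcases Q with _ | ⟨x₀, y₀, hQ0⟩
  · simp only [← WeierstrassCurve.Affine.Point.zero_def, add_zero] at hQ
    exact absurd hQ.symm (WeierstrassCurve.Affine.Point.some_ne_zero _)
  · by_cases hy : y₀ = W.toAffine.negY x₀ y₀
    · rw [WeierstrassCurve.Affine.Point.add_self_of_Y_eq hy] at hQ
      exact absurd hQ.symm (WeierstrassCurve.Affine.Point.some_ne_zero _)
    · rw [WeierstrassCurve.Affine.Point.add_self_of_Y_ne hy] at hQ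
      have hx : W.toAffine.addX x₀ x₀ (W.toAffine.slope x₀ x₀ y₀ y₀) = xP :=
        (WeierstrassCurve.Affine.Point.some.injEq _ _ _ _ _ _).mp hQ |>.1
      rw [WeierstrassCurve.Affine.slope_of_Y_ne rfl hy] at hx
      have hy0 : y₀ ≠ 0 := by
        intro h0; apply hy; rw [negY_of_a₁_a₃ W h1 h3, h0, neg_zero]
      have heq := equation_of_a₁_a₃ W h1 h3 hQ0.1
      simp only [negY_of_a₁_a₃ W h1 h3, WeierstrassCurve.Affine.addX, h1] at hx
      have h2y : (y₀ - -y₀) ≠ 0 := by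
        intro h0; apply hy0; linarith
      have hx1 : (3 * x₀ ^ 2 + 2 * W.a₂ * x₀ + W.a₄) ^ 2 = 4 * y₀ ^ 2 * (xP + W.a₂ + 2 * x₀) := by
        field_simp at hx
        linear_combination hx
      have hF := root_relation_of_a₁_a₃ W h1 h3
      have h16y : (16 * y₀) ≠ 0 := mul_ne_zero (by norm_num) hy0
      have hW0 := congrArg (algebraMap ℚ (twoDivisionAlgebra W)) (mul_inv_cancel₀ h16y)
      have heq' := congrArg (algebraMap ℚ (twoDivisionAlgebra W)) heq
      have hx1' := congrArg (algebraMap ℚ (twoDivisionAlgebra W)) hx1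
      simp only [map_mul, map_ofNat, map_pow, map_add, map_one] at hW0 heq' hx1'
      refine ⟨algebraMap ℚ (twoDivisionAlgebra W) ((16 * y₀)⁻¹) *
        ((algebraMap ℚ (twoDivisionAlgebra W) (4 * x₀) - twoDivisionRoot W) ^ 2 -
          (3 * twoDivisionRoot W ^ 2 + algebraMap ℚ (twoDivisionAlgebra W) (8 * W.a₂) * twoDivisionRoot W + algebraMap ℚ (twoDivisionAlgebra W) (16 * W.a₄))), ?_⟩
      simp only [map_mul, map_ofNat]
      generalize twoDivisionRoot W = t at hF ⊢
      generalize algebraMap ℚ (twoDivisionAlgebra W) ((16 * y₀)⁻¹) = Wc at hW0 ⊢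
      generalize algebraMap ℚ (twoDivisionAlgebra W) x₀ = X at heq' hx1' ⊢
      generalize algebraMap ℚ (twoDivisionAlgebra W) xP = XP at hx1' ⊢
      generalize algebraMap ℚ (twoDivisionAlgebra W) y₀ = Y at heq' hx1' hW0 ⊢
      generalize algebraMap ℚ (twoDivisionAlgebra W) W.a₂ = B at hF heq' hx1' ⊢
      generalize algebraMap ℚ (twoDivisionAlgebra W) W.a₄ = A4 at hF heq' hx1' ⊢
      generalize algebraMap ℚ (twoDivisionAlgebra W) W.a₆ = A6 at hF heq' ⊢
      linear_combination (-(256 * Wc ^ 2)) * hx1' + (-(256 * Wc ^ 2 * (4 * B + 8 * X + t))) * heq' +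
        (-(4 * Wc ^ 2 * (t + 8 * X + 4 * B))) * hF + (-((4 * XP - t) * (16 * Y * Wc + 1))) * hW0

/-- **CASSELS' LEMMA** (constructive): `4x_P − θ ∈ L^{2} ⇒ P ∈ 2E(ℚ)`, half `Q = (α₁/(4α₂) − a₂, −1/(8α₂))`. -/
theorem exists_halves_of_isSquare (W : WeierstrassCurve ℚ) (h1 : W.a₁ = 0) (h3 : W.a₃ = 0) {xP yP : ℚ} (hP : W.toAffine.Nonsingular xP yP)
    (hsq : IsSquare (algebraMap ℚ (twoDivisionAlgebra W) (4 * xP) - twoDivisionRoot W)) :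
    ∃ Q : W.toAffine.Point, Q + Q = WeierstrassCurve.Affine.Point.some xP yP hP := by
  obtain ⟨v, hv⟩ := hsq
  obtain ⟨α₀, α₁, α₂, hvexp⟩ := exists_coords W v
  have hF := root_relation_of_a₁_a₃ W h1 h3
  have hPeq := equation_of_a₁_a₃ W h1 h3 hP.1
  -- (1) α₂ ≠ 0
  have hα₂ : α₂ ≠ 0 := by
    intro h0
    have hA2 : algebraMap ℚ (twoDivisionAlgebra W) α₂ = 0 := by rw [h0, map_zero]
    have key : algebraMap ℚ (twoDivisionAlgebra W) (α₀ ^ 2 - 4 * xP) + algebraMap ℚ (twoDivisionAlgebra W) (2 * α₀ * α₁ + 1) * twoDivisionRoot W +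
        algebraMap ℚ (twoDivisionAlgebra W) (α₁ ^ 2) * twoDivisionRoot W ^ 2 = 0 := by
      simp only [map_add, map_sub, map_mul, map_pow, map_one, map_ofNat] at hv ⊢
      generalize twoDivisionRoot W = t at hv hvexp ⊢
      generalize algebraMap ℚ (twoDivisionAlgebra W) α₀ = A0 at hvexp ⊢
      generalize algebraMap ℚ (twoDivisionAlgebra W) α₁ = A1 at hvexp ⊢
      generalize algebraMap ℚ (twoDivisionAlgebra W) α₂ = A2 at hvexp hA2 ⊢
      generalize algebraMap ℚ (twoDivisionAlgebra W) xP = XP at hv ⊢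
      linear_combination (-1 : (twoDivisionAlgebra W)) * hv + (-(v + (A0 + A1 * t + A2 * t ^ 2))) * hvexp +
        (-(t ^ 2 * (2 * A0 + 2 * A1 * t + A2 * t ^ 2))) * hA2
    obtain ⟨-, h1', h2'⟩ := coords_eq_zero W _ _ _ key
    have : α₁ = 0 := pow_eq_zero_iff (two_ne_zero) |>.mp h2'
    rw [this] at h1'
    norm_num at h1'
  -- (2) the half `Q = (x₀, y₀)` and the defect `r`
  obtain ⟨y₀, hy⟩ : ∃ y₀ : ℚ, 8 * α₂ * y₀ = -1 :=
    ⟨-(8 * α₂)⁻¹, by rw [mul_neg, mul_inv_cancel₀ (mul_ne_zero (by norm_num) hα₂)]⟩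
  have hy0 : y₀ ≠ 0 := by rintro rfl; norm_num at hy
  obtain ⟨x₀, hx⟩ : ∃ x₀ : ℚ, 4 * α₂ * (x₀ + W.a₂) = α₁ :=
    ⟨α₁ / (4 * α₂) - W.a₂, by rw [sub_add_cancel, mul_div_cancel₀ _ (mul_ne_zero (by norm_num) hα₂)]⟩
  obtain ⟨r, hr⟩ : ∃ r : ℚ, r * y₀ = x₀ ^ 2 - W.a₄ - α₀ * y₀ :=
    ⟨(x₀ ^ 2 - W.a₄ - α₀ * y₀) / y₀, div_mul_cancel₀ _ hy0⟩
  have hy' := congrArg (algebraMap ℚ (twoDivisionAlgebra W)) hy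
  have hx' := congrArg (algebraMap ℚ (twoDivisionAlgebra W)) hx
  have hr' := congrArg (algebraMap ℚ (twoDivisionAlgebra W)) hr
  simp only [map_mul, map_ofNat, map_neg, map_one, map_add, map_sub, map_pow] at hy' hx' hr'
  -- (3) the coefficient equation in L
  have hK : algebraMap ℚ (twoDivisionAlgebra W) (256 * y₀ ^ 2 * r ^ 2 + 512 * y₀ ^ 2 * r * α₀ + 1024 * y₀ ^ 2 * xP -
        256 * (3 * x₀ ^ 2 + 2 * W.a₂ * x₀ + W.a₄) ^ 2 + 256 * (x₀ ^ 3 + W.a₂ * x₀ ^ 2 + W.a₄ * x₀ + W.a₆) * (4 * W.a₂ + 8 * x₀)) +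
      algebraMap ℚ (twoDivisionAlgebra W) (-256 * y₀ ^ 2 + 512 * y₀ ^ 2 * r * α₁ + 256 * (x₀ ^ 3 + W.a₂ * x₀ ^ 2 + W.a₄ * x₀ + W.a₆)) *
        twoDivisionRoot W +
      algebraMap ℚ (twoDivisionAlgebra W) (512 * y₀ ^ 2 * r * α₂) * twoDivisionRoot W ^ 2 = 0 := by
    simp only [map_mul, map_ofNat, map_neg, map_add, map_sub, map_pow] at hv ⊢
    generalize twoDivisionRoot W = t at hF hv hvexp ⊢
    generalize algebraMap ℚ (twoDivisionAlgebra W) x₀ = X0 at hx' hr' ⊢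
    generalize algebraMap ℚ (twoDivisionAlgebra W) xP = XP at hv ⊢
    generalize algebraMap ℚ (twoDivisionAlgebra W) y₀ = Y0 at hy' hr' ⊢
    generalize algebraMap ℚ (twoDivisionAlgebra W) r = Rr at hr' ⊢
    generalize algebraMap ℚ (twoDivisionAlgebra W) α₀ = A0 at hvexp hr' ⊢
    generalize algebraMap ℚ (twoDivisionAlgebra W) α₁ = A1 at hvexp hx' ⊢
    generalize algebraMap ℚ (twoDivisionAlgebra W) α₂ = A2 at hvexp hy' hx' ⊢
    generalize algebraMap ℚ (twoDivisionAlgebra W) W.a₂ = B at hF hx' ⊢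
    generalize algebraMap ℚ (twoDivisionAlgebra W) W.a₄ = A4 at hF hr' ⊢
    generalize algebraMap ℚ (twoDivisionAlgebra W) W.a₆ = A6 at hF ⊢
    have hMi : (4 * X0 - t) ^ 2 - (3 * t ^ 2 + 8 * B * t + 16 * A4) = 16 * Y0 * (v + Rr) := by
      linear_combination (-(16 * Y0)) * hvexp + (-(2 * t ^ 2) - 8 * (X0 + B) * t) * hy' + (16 * Y0 * t) * hx' +
        (-16 : (twoDivisionAlgebra W)) * hr'
    linear_combination (256 * Y0 ^ 2) * hv + (-(512 * Y0 ^ 2 * Rr)) * hvexp +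
      (-(16 * Y0 * (v + Rr) + ((4 * X0 - t) ^ 2 - (3 * t ^ 2 + 8 * B * t + 16 * A4)))) * hMi +
      (4 * (t + 8 * X0 + 4 * B)) * hF
  obtain ⟨hk0, hk1, hk2⟩ := coords_eq_zero W _ _ _ hK
  -- (4) read off: r = 0, the curve equation, x(2Q) = x_P
  have hr0 : r = 0 := by
    by_contra hne
    exact (mul_ne_zero (mul_ne_zero (mul_ne_zero (by norm_num) (pow_ne_zero 2 hy0)) hne) hα₂) hk2
  rw [hr0] at hk0 hk1
  have heq : y₀ ^ 2 = x₀ ^ 3 + W.a₂ * x₀ ^ 2 + W.a₄ * x₀ + W.a₆ := by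
    linear_combination (-1 / 256 : ℚ) * hk1
  have hdup : (3 * x₀ ^ 2 + 2 * W.a₂ * x₀ + W.a₄) ^ 2 = 4 * y₀ ^ 2 * (xP + W.a₂ + 2 * x₀) := by
    linear_combination (-1 / 256 : ℚ) * hk0 + (-(4 * W.a₂ + 8 * x₀)) * heq
  -- (5) the point Q = (x₀, y₀)
  have hQns : W.toAffine.Nonsingular x₀ y₀ := by
    rw [WeierstrassCurve.Affine.nonsingular_iff']
    refine ⟨?_, Or.inr ?_⟩
    · rw [WeierstrassCurve.Affine.equation_iff']
      simp only [h1, h3, zero_mul, add_zero]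
      linear_combination heq
    · simp only [h1, h3, zero_mul, add_zero]
      intro h0; apply hy0; linarith
  have hyne : y₀ ≠ W.toAffine.negY x₀ y₀ := by
    rw [negY_of_a₁_a₃ W h1 h3]; intro h0; apply hy0; linarith
  obtain ⟨X2, Y2, H2, hQQ, hX2⟩ : ∃ (X2 Y2 : ℚ) (H2 : W.toAffine.Nonsingular X2 Y2),
      WeierstrassCurve.Affine.Point.some x₀ y₀ hQns + WeierstrassCurve.Affine.Point.some x₀ y₀ hQns =
        WeierstrassCurve.Affine.Point.some X2 Y2 H2 ∧ X2 = xP := by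
    refine ⟨_, _, _, WeierstrassCurve.Affine.Point.add_self_of_Y_ne hyne, ?_⟩
    rw [WeierstrassCurve.Affine.slope_of_Y_ne rfl hyne]
    simp only [negY_of_a₁_a₃ W h1 h3, WeierstrassCurve.Affine.addX, h1]
    have h2y : (y₀ - -y₀) ≠ 0 := by intro h0; apply hy0; linarith
    field_simp
    linear_combination hdup
  have hY2 : Y2 ^ 2 = yP ^ 2 := by
    have := equation_of_a₁_a₃ W h1 h3 H2.1
    rw [hX2] at this
    linear_combination this - hPeq
  have key : ∀ {x y : ℚ} {hxy : W.toAffine.Nonsingular x y}, x = xP → y = yP →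
      WeierstrassCurve.Affine.Point.some x y hxy = WeierstrassCurve.Affine.Point.some xP yP hP := by
    rintro x y hxy rfl rfl; rfl
  rcases sq_eq_sq_iff_eq_or_eq_neg.mp hY2 with hc1 | hc2
  · exact ⟨WeierstrassCurve.Affine.Point.some x₀ y₀ hQns, hQQ.trans (key hX2 hc1)⟩
  · refine ⟨-WeierstrassCurve.Affine.Point.some x₀ y₀ hQns, ?_⟩
    rw [← neg_add, hQQ, WeierstrassCurve.Affine.Point.neg_some]
    apply key hX2
    rw [negY_of_a₁_a₃ W h1 h3, hc2, neg_neg]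

/-- **Cassels' lemma, both directions**, for every `W/ℚ` with `a₁ = a₃ = 0`. -/
theorem halves_iff_isSquare (W : WeierstrassCurve ℚ) (h1 : W.a₁ = 0) (h3 : W.a₃ = 0) {xP yP : ℚ} (hP : W.toAffine.Nonsingular xP yP) :
    (∃ Q : W.toAffine.Point, Q + Q = WeierstrassCurve.Affine.Point.some xP yP hP) ↔
      IsSquare (algebraMap ℚ (twoDivisionAlgebra W) (4 * xP) - twoDivisionRoot W) :=
  ⟨fun ⟨Q, hQ⟩ => isSquare_of_halves W h1 h3 hP Q hQ, exists_halves_of_isSquare W h1 h3 hP⟩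

/-- DESC-§22-H′ (support, KNOWN in print as Cassels' lemma; uniform `AdjoinRoot` form): for every `W : y² = x³ + a₂x² + a₄x + a₆` over `ℚ` and every
`P = (x_P, y_P) ∈ W(ℚ)`: `P ∈ 2W(ℚ) ⟺ 4x_P − θ_W ∈ (ℚ[T]/(c_W))^{2}`.  PROVED (`kummerHalvingCriterion_holds`); row H
(`F1Sign2.KummerHalvingCriterionAtTwo`, p624323) is the instance `W = gmPartner a b c`.
REF1-AUDIT §92/§94 (g9, D-desc-ref1-24 + extension, 10:24:02Z/10:59:52Z): SURVIVES, PROVED, CLEARED (with H; m1: `a₁ = a₃ = 0` is a normal form — the criterion holds for every W/ℚ by completing the square, x preserved — info only); landing certificate p625024 ← `KummerGeneral.lean` 55246eaab182a892 14 SAME / 0 DIFF (only-planner `halves_iff_isSquare_gmPartner`, the announced duplicate).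
REF2-PLACEMENT v24 §1 (45974357b6e499b5, D-desc-ref2-24, 10:27:23Z): KNOWN — Cassels 1991 LMSST §15 Lemma 2 (étale-algebra form: Schaefer–Stoll); formalisation; beyond-print no; PARTITION none.
[cite: Cassels1991, §15 Lemma 2] -/
def KummerHalvingCriterion : Prop :=
  ∀ (W : WeierstrassCurve ℚ), W.a₁ = 0 → W.a₃ = 0 → ∀ (xP yP : ℚ) (hP : W.toAffine.Nonsingular xP yP),
    (∃ Q : W.toAffine.Point, Q + Q = WeierstrassCurve.Affine.Point.some xP yP hP) ↔
      IsSquare (algebraMap ℚ (twoDivisionAlgebra W) (4 * xP) - twoDivisionRoot W)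

/-- **Row DESC-§22-H′ HOLDS** (Cassels' lemma, both directions, every `W` with `a₁ = a₃ = 0`; kernel). -/
theorem kummerHalvingCriterion_holds : KummerHalvingCriterion :=
  fun W h1 h3 _ _ hP => halves_iff_isSquare W h1 h3 hP

/-- The two curves of the cell: `E_f = gmCurve a b c` and `E′_f = gmPartner a b c` have `a₁ = a₃ = 0`. -/
theorem halves_iff_isSquare_gmCurve (a b c : ℤ) {xP yP : ℚ} (hP : (gmCurve a b c).toAffine.Nonsingular xP yP) :
    (∃ Q : (gmCurve a b c).toAffine.Point, Q + Q = WeierstrassCurve.Affine.Point.some xP yP hP) ↔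
      IsSquare (algebraMap ℚ (twoDivisionAlgebra (gmCurve a b c)) (4 * xP) - twoDivisionRoot (gmCurve a b c)) :=
  halves_iff_isSquare (gmCurve a b c) (by simp [gmCurve]) (by simp [gmCurve]) hP

end Summit.BirchSwinnertonDyer.Rank1Residual.F1Sign2.Kummer

end
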